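import Summits.ResolutionOfSingularities.ResolutionOfSingularities.Theorems.MarkedTransferCampaignW46MohWindowSurfaceStallThread
import Summits.ResolutionOfSingularities.ResolutionOfSingularities.Theorems.MarkedTransferCampaignW46MohWindowSurfaceChildCount
import Summits.ResolutionOfSingularities.ResolutionOfSingularities.Theorems.MarkedTransferCampaignW46MohWindowSurfaceHeavyCore
import Summits.ResolutionOfSingularities.ResolutionOfSingularities.Theorems.MarkedTransferCampaignW46MohWindowSurfaceHeavyChart
import HarnessLib

/-!
# [OURS · L1 W4.6 rung (iii-2), EVERY `p`] Surface Moh window — res-D-pv-050's ABSTRACT CHART DATUM with the factorisation hypothesis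
# LOCALIZED AT THE PRIME UNDER THE POINT (part 1 of the heavy-root location; cell res-hironaka,
# LADDER-RESOLUTION rung L, D-0089; seat res-L1-s46-pv-5 gen 5; host MarkedTransfer, `--supports stmt-ResolutionOfSingularities-16155
# --as helper`; statement file `…CampaignW46MohWindowSurface.lean`)

HONEST FRAMING. Nothing here is a statement of H. Hironaka's manuscript [Hironaka2017] and nothing here asserts that any
statement of it holds. The stalling thread (`…StallThread.lean`) of an infinite in-regime sequence is blown up infinitely often with
NON-DROPPING residual order. This file locates such a child: res-D-pv-050's chart datum (`…HeavyChart.lean`,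
`exists_core_data_of_chartDatum_of_factor` / `exists_core_data_of_factor`) is re-run with the factorisation hypothesis required ONLY
for the prime `π` of `κ[Y]` UNDER THE POINT (`exists_core_data_of_chartDatum_at`, `exists_core_data_at` — same proofs, the prime made
explicit), so that res-D-pv-050's bound `d″ + p ≤ d + μ` (`core_le_window`) holds with `μ` the multiplicity of THAT prime; if the child
does not drop (`d″ ≥ d`) then `μ ≥ p`, the prime is LINEAR, `π = ᾱ Y + β̄`, `π^p` divides the chart's residue polynomial (the centre is
HEAVY with `κ`-rational heavy root `−β̄/ᾱ`) and the child lies ON THE LINE `{c_j = 0, z/c_j = 0}` AT THAT ROOT (`α̃ · y/c_j + β̃ ∈ 𝔴`;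
`exponent_lt_or_heavyRoot_of_chart`). This is the coordinate information the (H2) entrance door needs along a heavy thread. AI-written; AI
review is weaker than expert review. No `sorry`; axioms standard.
[ZariskiSamuel1960] [Matsumura1987] [HauserWagner2014] [CossartPiltant2008]
-/

noncomputable section

set_option linter.dupNamespace false -- mandated namespace of this single-conjunct summit

namespace Summit.ResolutionOfSingularities.ResolutionOfSingularities.Theorems.CampaignW46.MohWindowSurface

open IsLocalRing Polynomial
open Literature.AlgebraicGeometry.Resolution

universe u

variable {R : Type u} [CommRing R] [IsRegularLocalRing R]

/-! ## 1. The chart datum with the prime under the point explicit (res-D-pv-050's proof, hypothesis localized) -/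

omit [IsRegularLocalRing R] in
/-- **res-D-pv-050's abstract chart datum, factorisation hypothesis LOCALIZED AT THE POINT** (`…HeavyChart.lean`,
`exists_core_data_of_chartDatum_of_factor`, same proof): the factorisation `Σ ā_k X^{u_k} = π^μ · G₀`, `π ∤ G₀`, `P μ` is required only
for primes `π` such that `θ(π(Y))` is the reduction of an element of `𝔴` — i.e. for THE prime of `κ[Y]` under the point. NOT a statement of
the manuscript. [folklore] -/
theorem exists_core_data_of_chartDatum_at [IsLocalRing R] {B L : Type u} [CommRing B] [CommRing L]
    [IsLocalRing L] (φ : R →+* B) (alg : B →+* L) (t : B) (e : Fin 3 → B) {i i' : Fin 3} (hi : i ≠ 2) (hi' : i' ≠ 2)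
    (hii' : i ≠ i') (θ : MvPolynomial {j : Fin 3 // j ≠ i} (ResidueField R) ≃+* B ⧸ Ideal.span {t})
    (hθC : ∀ r : R, θ (MvPolynomial.C (residue R r)) = Ideal.Quotient.mk (Ideal.span {t}) (φ r))
    (hθX : ∀ s : {j : Fin 3 // j ≠ i}, θ (MvPolynomial.X s) = Ideal.Quotient.mk (Ideal.span {t}) (e s.1))
    (𝔴 : Ideal B) [𝔴.IsPrime] (ht𝔴 : t ∈ 𝔴) (hz : e 2 ∈ 𝔴)
    (hmem : ∀ b : B, alg b ∈ maximalIdeal L ↔ b ∈ 𝔴) (hunit : ∀ b : B, IsUnit (alg b) ↔ b ∉ 𝔴)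
    (hmL : maximalIdeal L = 𝔴.map alg) (h3L : (maximalIdeal L).spanFinrank = 3)
    {d : ℕ} (a : ℕ → R) (u : ℕ → ℕ) {P : ℕ → Prop}
    (hfac : ∀ π : (ResidueField R)[X], Prime π →
      (∃ b ∈ 𝔴, Ideal.Quotient.mk (Ideal.span {t}) b =
        θ ((Polynomial.aeval (MvPolynomial.X (⟨i', fun h => hii' h.symm⟩ : {j : Fin 3 // j ≠ i})) :
          (ResidueField R)[X] →ₐ[ResidueField R] MvPolynomial {j : Fin 3 // j ≠ i} (ResidueField R)).toRingHom π)) →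
      ∃ (μ : ℕ) (G₀ : (ResidueField R)[X]),
      P μ ∧ (∑ k ∈ Finset.range (d + 1), C (residue R (a k)) * X ^ (u k)) = π ^ μ * G₀ ∧ ¬ π ∣ G₀) :
    ∃ (ρ G : L) (μ : ℕ), P μ ∧ IsUnit G ∧ Ideal.span {alg t, ρ, alg (e 2)} = maximalIdeal L ∧
      (∑ k ∈ Finset.range (d + 1), alg (φ (a k)) * alg (e i') ^ (u k)) - ρ ^ μ * G ∈ Ideal.span {alg t} := by
  classical
  set sY : {j : Fin 3 // j ≠ i} := ⟨i', fun h => hii' h.symm⟩ with hsY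
  set sZ : {j : Fin 3 // j ≠ i} := ⟨2, fun h => hi h.symm⟩ with hsZ
  have hσ : ∀ s : {j : Fin 3 // j ≠ i}, s = sY ∨ s = sZ := subtype_eq_or_eq hi hi' hii'
  -- the prime `𝔴̄` of `B/(t)` and its pull-back `𝔫` to `κ[Y, Z]`
  have hK𝔴 : Ideal.span {t} ≤ 𝔴 := by rw [Ideal.span_le, Set.singleton_subset_iff]; exact ht𝔴
  set mkK := Ideal.Quotient.mk (Ideal.span {t}) with hmkK
  have hker : RingHom.ker mkK ≤ 𝔴 := by rw [hmkK, Ideal.mk_ker]; exact hK𝔴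
  set 𝔴bar : Ideal (B ⧸ Ideal.span {t}) := 𝔴.map mkK with h𝔴bar
  haveI : 𝔴bar.IsPrime := Ideal.map_isPrime_of_surjective Ideal.Quotient.mk_surjective hker
  have hcomap𝔴 : 𝔴bar.comap mkK = 𝔴 := by
    rw [h𝔴bar, Ideal.comap_map_of_surjective _ Ideal.Quotient.mk_surjective]
    refine le_antisymm (sup_le le_rfl fun b hb => hker ?_) le_sup_left
    rw [← RingHom.ker_eq_comap_bot] at hb
    exact hb
  set 𝔫 : Ideal (MvPolynomial {j : Fin 3 // j ≠ i} (ResidueField R)) := 𝔴bar.comap θ with h𝔫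
  haveI h𝔫prime : 𝔫.IsPrime := Ideal.IsPrime.comap _
  have hmap𝔫 : 𝔫.map θ = 𝔴bar := by
    rw [h𝔫, Ideal.map_comap_of_surjective θ θ.surjective]
  have hXZ : MvPolynomial.X sZ ∈ 𝔫 := by
    rw [h𝔫, Ideal.mem_comap, hθX]
    exact Ideal.mem_map_of_mem _ hz
  -- the trace `𝔫₀ = (π)` of `𝔫` on `κ[Y]`
  set ι : (ResidueField R)[X] →+* MvPolynomial {j : Fin 3 // j ≠ i} (ResidueField R) :=
    (Polynomial.aeval (MvPolynomial.X sY) :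
      (ResidueField R)[X] →ₐ[ResidueField R] MvPolynomial {j : Fin 3 // j ≠ i} (ResidueField R)).toRingHom
    with hι
  have hιC : ∀ r : ResidueField R, ι (C r) = MvPolynomial.C r := fun r => by
    rw [hι, AlgHom.toRingHom_eq_coe, RingHom.coe_coe, Polynomial.aeval_C, MvPolynomial.algebraMap_eq]
  have hιX : ι X = MvPolynomial.X sY := by
    rw [hι, AlgHom.toRingHom_eq_coe, RingHom.coe_coe, Polynomial.aeval_X]
  have h𝔫eq : 𝔫 = Ideal.span {MvPolynomial.X sZ} ⊔ (𝔫.comap ι).map ι := ideal_eq_span_X_sup_map sY sZ hσ 𝔫 hXZ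
  set 𝔫₀ : Ideal (ResidueField R)[X] := 𝔫.comap ι with h𝔫₀
  haveI : 𝔫₀.IsPrime := Ideal.IsPrime.comap _
  haveI : 𝔫₀.IsPrincipal := IsPrincipalIdealRing.principal 𝔫₀
  set π : (ResidueField R)[X] := Submodule.IsPrincipal.generator 𝔫₀ with hπdef
  have h𝔫₀eq : 𝔫₀ = Ideal.span {π} := (Ideal.span_singleton_generator 𝔫₀).symm
  -- `𝔴 = (e₂, bπ) + (t)` for a lift `bπ` of `θ (ι π)`
  obtain ⟨bπ, hbπ⟩ := Ideal.Quotient.mk_surjective (I := Ideal.span {t}) (θ (ι π))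
  have h𝔴eq : 𝔴 = Ideal.span {e 2, bπ} ⊔ Ideal.span {t} := by
    have h1 : 𝔴bar = Ideal.span {mkK (e 2), mkK bπ} := by
      have hA : (Ideal.span {MvPolynomial.X sZ}).map θ = Ideal.span {mkK (e 2)} := by
        rw [Ideal.map_span, Set.image_singleton, hθX]
      have hB : ((Ideal.span {π}).map ι).map θ = Ideal.span {mkK bπ} := by
        rw [Ideal.map_span, Set.image_singleton, Ideal.map_span, Set.image_singleton, hbπ]
      rw [← hmap𝔫, h𝔫eq, h𝔫₀eq, Ideal.map_sup, hA, hB, Ideal.span_insert]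
    have h2 : Ideal.span {mkK (e 2), mkK bπ} = (Ideal.span {e 2, bπ}).map mkK := by
      rw [Ideal.map_span, Set.image_insert_eq, Set.image_singleton]
    rw [← hcomap𝔴, h1, h2, Ideal.comap_map_of_surjective _ Ideal.Quotient.mk_surjective, ← RingHom.ker_eq_comap_bot,
      Ideal.mk_ker]
  -- membership helpers for the small generating sets
  have m2a : alg t ∈ ({alg (e 2), alg t} : Set L) := Set.mem_insert_of_mem _ (Set.mem_singleton _)
  have m2b : alg (e 2) ∈ ({alg (e 2), alg t} : Set L) := Set.mem_insert _ _
  -- case `π = 0` is impossible: then `𝔪_L = (e₂, t)` has at most two generators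
  have hπ0 : π ≠ 0 := by
    intro hπ0
    have hbπK : bπ ∈ Ideal.span {t} := by
      rw [← Ideal.Quotient.eq_zero_iff_mem, hbπ, hπ0, map_zero, map_zero]
    have h𝔴le : 𝔴 ≤ Ideal.span {e 2, t} := by
      rw [h𝔴eq]
      refine sup_le ?_ ?_
      · rw [Ideal.span_le]
        rintro b (rfl | rfl)
        · exact Ideal.subset_span (Set.mem_insert _ _)
        · obtain ⟨r, rfl⟩ := Ideal.mem_span_singleton'.mp hbπK
          exact Ideal.mul_mem_left _ _ (Ideal.subset_span (Set.mem_insert_of_mem _ (Set.mem_singleton _)))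
      · rw [Ideal.span_le, Set.singleton_subset_iff]
        exact Ideal.subset_span (Set.mem_insert_of_mem _ (Set.mem_singleton _))
    have hmLle : maximalIdeal L ≤ Ideal.span {alg (e 2), alg t} := by
      rw [hmL]
      refine (Ideal.map_mono h𝔴le).trans ?_
      rw [Ideal.map_span, Set.image_insert_eq, Set.image_singleton]
    have hmLge : Ideal.span {alg (e 2), alg t} ≤ maximalIdeal L := by
      rw [Ideal.span_le]
      rintro b (rfl | rfl)
      · exact (hmem _).mpr hz
      · exact (hmem _).mpr ht𝔴
    have heq : maximalIdeal L = Ideal.span {alg (e 2), alg t} := le_antisymm hmLle hmLge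
    have hfin : ({alg (e 2), alg t} : Set L).Finite := (Set.finite_singleton _).insert _
    have hle2 : (maximalIdeal L).spanFinrank ≤ 2 := by
      rw [heq]
      refine (Submodule.spanFinrank_span_le_ncard_of_finite hfin).trans ?_
      refine (Set.ncard_insert_le _ _).trans ?_
      rw [Set.ncard_singleton]
    omega
  -- so `π` is a prime of `κ[Y]`; the HYPOTHESIS factors the residue polynomial as `π^μ · G₀`, `π ∤ G₀`, `P μ`
  have hπprime : Prime π := Submodule.IsPrincipal.prime_generator_of_isPrime 𝔫₀ (by
    rw [h𝔫₀eq]; exact fun h => hπ0 (Ideal.span_singleton_eq_bot.mp h))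
  have hbπ𝔴 : bπ ∈ 𝔴 := by
    rw [h𝔴eq]
    exact Ideal.mem_sup_left (Ideal.subset_span (Set.mem_insert_of_mem _ (Set.mem_singleton _)))
  obtain ⟨μ, G₀, hμp, hFeq, hndvd⟩ := hfac π hπprime ⟨bπ, hbπ𝔴, hbπ⟩
  have hG₀ : ι G₀ ∉ 𝔫 := by
    intro h
    have : G₀ ∈ 𝔫₀ := h
    rw [Submodule.IsPrincipal.mem_iff_generator_dvd 𝔫₀] at this
    exact hndvd this
  obtain ⟨bG, hbG⟩ := Ideal.Quotient.mk_surjective (I := Ideal.span {t}) (θ (ι G₀))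
  -- the chart element `fB = Σ φ(a_k) e_{i'}^{u_k}` reduces to `θ (ι F̄)`
  set fB : B := ∑ k ∈ Finset.range (d + 1), φ (a k) * e i' ^ (u k) with hfB
  have hfBbar : mkK fB = θ (ι (∑ k ∈ Finset.range (d + 1), C (residue R (a k)) * X ^ (u k))) := by
    rw [hfB, map_sum, map_sum, map_sum]
    refine Finset.sum_congr rfl fun k _ => ?_
    rw [map_mul, map_pow, map_mul, map_pow, hιC, hιX, map_mul, map_pow, hθC, hθX]
  have hdiffK : fB - bπ ^ μ * bG ∈ Ideal.span {t} := by
    rw [← Ideal.Quotient.eq_zero_iff_mem, map_sub, map_mul, map_pow, hfBbar, hbπ, hbG, hFeq, map_mul, map_pow,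
      map_mul, map_pow, sub_self]
  -- transport to `L`
  refine ⟨alg bπ, alg bG, μ, hμp, ?_, ?_, ?_⟩
  · -- `G` is a unit: `bG ∉ 𝔴`
    refine (hunit bG).mpr fun hbG𝔴 => hG₀ ?_
    rw [h𝔫, Ideal.mem_comap, ← hbG]
    exact Ideal.mem_map_of_mem _ hbG𝔴
  · -- `𝔪_L = (t, ρ, e₂)`
    apply le_antisymm
    · rw [Ideal.span_le]
      rintro b (rfl | rfl | rfl)
      · exact (hmem _).mpr ht𝔴
      · refine (hmem _).mpr ?_
        rw [h𝔴eq]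
        exact Ideal.mem_sup_left (Ideal.subset_span (Set.mem_insert_of_mem _ (Set.mem_singleton _)))
      · exact (hmem _).mpr hz
    · have m3a : alg t ∈ ({alg t, alg bπ, alg (e 2)} : Set L) := Set.mem_insert _ _
      have m3b : alg bπ ∈ ({alg t, alg bπ, alg (e 2)} : Set L) := Set.mem_insert_of_mem _ (Set.mem_insert _ _)
      have m3c : alg (e 2) ∈ ({alg t, alg bπ, alg (e 2)} : Set L) :=
        Set.mem_insert_of_mem _ (Set.mem_insert_of_mem _ (Set.mem_singleton _))
      rw [hmL, h𝔴eq, Ideal.map_sup, Ideal.map_span, Set.image_insert_eq, Set.image_singleton, Ideal.map_span,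
        Set.image_singleton]
      refine sup_le ?_ ?_
      · rw [Ideal.span_le]
        rintro b (rfl | rfl)
        · exact Ideal.subset_span m3c
        · exact Ideal.subset_span m3b
      · rw [Ideal.span_le, Set.singleton_subset_iff]
        exact Ideal.subset_span m3a
  · -- `Σ φ(a_k) e_{i'}^{u_k} − ρ^μ G ∈ (t)`
    obtain ⟨r, hr⟩ := Ideal.mem_span_singleton'.mp hdiffK
    have himg : alg fB - alg bπ ^ μ * alg bG = alg r * alg t := by
      rw [← map_pow, ← map_mul, ← map_sub, ← hr, map_mul]
    have hfBimg : alg fB = ∑ k ∈ Finset.range (d + 1), alg (φ (a k)) * alg (e i') ^ (u k) := by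
      rw [hfB, map_sum]
      refine Finset.sum_congr rfl fun k _ => ?_
      rw [map_mul, map_pow]
    rw [← hfBimg, himg]
    exact Ideal.mul_mem_left _ _ (Ideal.mem_span_singleton_self _)



end Summit.ResolutionOfSingularities.ResolutionOfSingularities.Theorems.CampaignW46.MohWindowSurface

end
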